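import Literature.NumberTheory.EllipticCurves.Gamma0CocycleDegeneracyMaps
import Literature.NumberTheory.EllipticCurves.GlobalMinimalModel
import Literature.NumberTheory.EllipticCurves.GaloisAction
import HarnessLib
import HarnessLib.Audit.Tags

/-!
# Candidate E-es-25ᴴ (line-facing HOMOLOGICAL currency): `RelativeIharaCokernelOfCurve p t n` — the relative Ihara
# statement at a shift `t^n` dividing the level, localised at a maximal ideal BELONGING TO an elliptic curve with
# irreducible `W₀[p]` — cell `bsd-f2-manin` (D-0131 (3) frontier). `@[conjecture]` leaf (NOTHING asserted; one def).

HONEST FRAMING. LENS = Euler systems / explicit reciprocity (planner `bsd-f2-manin-es` g9–g11, HOME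
`run/shared/lean/pub/bsd-f2-manin/MEMO-es.md` §21–§23). This is the SAME row E-es-25 as the cohomological leaf
`RelativeIharaShiftVanishingBar p t n` (`…/ManinAdditive/RelativeIharaShiftVanishing.lean`), written in the elementwise
homological currency of the tree fact `ribet1984_iharaLemma` (`Literature/NumberTheory/EllipticCurves/ModularCurveIharaLemma.lean`):
`H₁(X₀(N), ℤ) = periodHomology N`, push-forwards `(ι_d)_* = (degeneracyMap0 N L d 2).dualMap`, the prime-to-`tN` Hecke
ring `𝕋̃ = HeckeRing0.primeTo N 2 (t·N)` and «the localisation at `𝔫` of the cokernel of `(ι_d)_* − (ι_1)_*` vanishes»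
as «some `s ∈ 𝕋̃ ∖ 𝔫` carries `H₁(X₀(N), ℤ)` into the image». Source of the Prop: the typer's g4 text
HOME/typer/T-es-12-EsG9-RelativeIharaHomological.lean sha16 ecf6b2f2d5f8d0ff (`EsG9Typed.RelativeIharaCokernelOfCurve`,
farm rc 0 on the landed vocabulary), written at the line prover's request (p3, STATUS 2026-08-28T01:22:44Z) and
ENDORSED VERBATIM by es as the LINE-FACING text of E-es-25 for `p` odd (MEMO-es §22.6 (a)); the body below is that text
verbatim (its guards `p.Prime → t.Prime → 1 ≤ n → d = t ^ n → L = d * N` are part of it). The two currencies are related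
by Pontryagin/Nakayama duality at `𝔫` («cokernel_𝔫 = 0 ⟺ every exact `𝔫`-torsion functional killing the image
vanishes», MEMO-es §22.6 (a)) — NOT proved in the tree; hence two leaves for one row.

THE ROW. **E-es-25ᴴ `RelativeIharaCokernelOfCurve p t n`**: for primes `p`, `t` (`t = p`, `t ∣ N` allowed), `n ≥ 1`,
`d = t^n`, `L = dN`: for every globally minimal `W₀/ℚ` with `W₀[p]` irreducible and every maximal ideal `𝔫 ⊂ 𝕋̃ =
ℤ[T_r : r ∤ tN]` of level `N`, weight `2`, containing `p` and BELONGING to `W₀` (`T_r − a_r(W₀) ∈ 𝔫` for all primes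
`r ∤ tN·N_{W₀}·p`, `a_r = W₀.frobeniusTrace r`), some `s ∉ 𝔫` carries every `x ∈ H₁(X₀(N), ℤ)` into
`((ι_d)_* − (ι_1)_*) H₁(X₀(L), ℤ)`. WHY THE CELL WANTS IT: at `(3,3,1)` it is, up to reading `s ∉ 𝔫_f` as
`s f = m f, 3 ∤ m`, the hypothesis of the line provers' `shiftClassGenerationThree_of_hecke_cokernel` /
`exists_hecke_cokernel_three_of_relativeIharaCokernelOfCurve` (Theorems/ManinLocalTwoThreeGenerationHeckeCharacter.lean,
p597276: `(h : <this body at (3,3,1)>)`) and of the lever `katoShiftTwistManinThree_of_shiftStep_of_relativeIharaCokernelOfCurve`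
(…HeckeCharacterLever.lean) ⟹ E-es-18 `KatoShiftTwistManinThree` ⟹ (with the reducible residual) crux C3
`ManinPrimeToThreeAtNine` (stmt-BirchSwinnertonDyer-22968) for all 214 840 `W[3]`-irreducible optimal classes with
`9 ∣ N`; `p = 2` twin for the `S₃`-image part of C2 (stmt-BirchSwinnertonDyer-22967) needs the multi-shift telescope.
STATUS CLAIMED BY es (§22 for `p` odd via the tree's Ihara fact; §23, g11, for all `(p,t,n)` via cusp-symbol descent +
the tree THEOREM `SerreSL2Congruence1970_congruenceSubgroupProperty_away_holds` + f3-mu's `deltaEqGamma0MulUpper`, no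
Ihara fact): THEOREM-candidate; for `p` odd «`W₀[p]` irreducible» = «absolutely irreducible» (complex conjugation has
`det = −1`; Darmon–Diamond–Taylor 1995 p. 87; Literature fact `not_isEisensteinEigensystem_of_hasIrreducibleModPGaloisRep`,
typer p596515), so every `𝔫` of the statement is non-Eisenstein in the two-character sense; at `p = 2` the statement
ALSO covers the `C₃`-image curves (`W₀[2]` irreducible, `Δ` a square: 3 950 C2 classes), where `𝔫` IS Eisenstein over
`𝔽₄` and es's mechanism gives nothing — there it is a genuine unproved LAW, data-true at the census levels 196, 392, 784
(HOME/es/E19B-SHIFT2-levels-v1.tsv 055a83920c785e77, B-rows: `dimW*_H = dia`).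

NOT IN PRINT as a statement (cell refuter-1 §R42 placement SIGNAL: the `p = t`, `n = 1` case is probably Khare 1995,
Duke Math. J. 80, «Congruences between cusp forms: the (p,p) case», §2 — acq-09663, NOT held; refuter-2 R-es-22(b)
pending): printed = the classical `t ∤ N`, `n = 1` Ihara lemma for `Γ₀` at non-Eisenstein `𝔫` of ODD residue
characteristic (Ribet 1984 Thm. 4.1; Darmon–Diamond–Taylor 1995 Lemma 4.28 (a) p. 135 + Lemma 4.30 (b) p. 136 under the
standing «`ℓ` odd» of §4.2 p. 111 = tree fact `ribet1984_iharaLemma` with binder `2 ∉ 𝔫`), Wiles 1995 Lemma 2.5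
(= DDT 4.28 (b): `Γ₁`, one power step, `ℓ` odd), Diamond–Taylor 1994 (multi-copy, `t ∤ N`), Diamond–Ribet 1997 p. 371 /
Lemma 4.6 (`Γ₀` cokernel Eisenstein, `m_p ≤ 1`). The relative form at `t^k ∥ N` arbitrary, shift `t^n`, `p = t` and
`p = 2` included, is not found (es MEMO-es §21.5/§22.9, both corpora).

BC5 WITNESS (cell census of record): HOME/es/E18B-SHIFT3-levels-v1.tsv 1a40491e51294edf · `(3,3,1)` on all 76 levels
`N = 9k`, `27 ≤ N ≤ 702` · 76/76: the Hecke-stable shift-annihilator in `H¹(X₀(N), 𝔽₃)` is exactly the Eisenstein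
diamond span (no system belonging to a curve with irreducible `W[3]` survives) · violations 0; HOME/es/E21-SHIFTP
1e9663aa6aefd11d · `(P,P,1)`, `P ∈ {3,5,7}` · 68/68 · violations 0; HOME/es/E19B-SHIFT2-levels-v1.tsv 055a83920c785e77
· `p = 2`, 196/196 levels `4k ≤ 800`. Beyond-print rows: n/a (statement about `H₁`, not `c_E`). Cheapest falsifiers
not yet run: D-es-8 (mixed `(p,t)`, `n ≥ 2`).
REFUTER VERDICTS: REF1 R-es-21 (2026-08-28T02:22:55Z, HOME/REFUTER-ref1.md §R42 bffacb8566617e7d =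
HOME/ref1/R42-ref1-relative-ihara.md fd38b35e4a576fa6): **E-es-25 SURVIVES — THEOREM-candidate**; the typed homological
rows `RelativeIharaCokernel p t n` / `RelativeIharaCokernelOfCurve p t n` **CLEAN** (A1 rc 0 on the tree vocabulary —
HOME/ref1-C49T-typer-relativeIhara.lean dea8d1a8e55808fe, 434.7 s —, BC7 CLEAN ×5 incl. the closed instances
`S25H331 := RelativeIharaCokernelOfCurve 3 3 1`, `S25H223`, `S25H2q1`; parameters guarded; junk ⟺ reducible handled by
`HasIrreducibleModPGaloisRep` at `p = 2, 3`; proved bridge `ofCurve_of_abstract`); R-es-22 (a) (es g10 §22) and R-es-23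
(§23) pending. REF2 R-es-22 (b) pending. Only the curve form is filed: the abstract-ideal form `RelativeIharaCokernel`
(hypothesis «`𝔫` not NARROW-Eisenstein») is NOT filed — es does not endorse narrow-Eisenstein exclusions (MEMO-es
§22.6 (b): boundary systems `χ(r) + rχ⁻¹(r)` with non-quadratic `χ`).
-/

noncomputable section

open scoped MatrixGroups ModularForm

open CongruenceSubgroup WeierstrassCurve
  Literature.NumberTheory.EllipticCurves Literature.NumberTheory.EllipticCurves.ModularForms

namespace Summit.BirchSwinnertonDyer.Rank1Residual.ManinAdditive

/-- **Candidate E-es-25ᴴ `RelativeIharaCokernelOfCurve p t n` (cell bsd-f2-manin; homological line-facing currency of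
E-es-25, es-endorsed verbatim; nothing asserted).** For every globally minimal elliptic `W₀/ℚ` with `W₀[p]`
irreducible; all `N, d, L ≥ 1` with `p`, `t` prime, `1 ≤ n`, `d = t^n`, `L = d·N`; every maximal ideal `𝔫` of
`𝕋̃ = ℤ[T_r : r prime, r ∤ tN]` (`HeckeRing0.primeTo N 2 (t * N)`, level `N`, weight `2`) with `p ∈ 𝔫` that BELONGS
to `W₀` (`T_r − a_r(W₀) ∈ 𝔫` for every prime `r ∤ tN` with `r ∤ N_{W₀}·p`, `a_r(W₀) = W₀.frobeniusTrace r`): there is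
`s ∈ 𝕋̃ ∖ 𝔫` such that every `x ∈ H₁(X₀(N), ℤ) = periodHomology N` has `s • x = (ι_d)_* z − (ι_1)_* z` for some
`z ∈ H₁(X₀(L), ℤ)` (`(ι_e)_* = (degeneracyMap0 N L e 2).dualMap`) — i.e. the cokernel of `(ι_{t^n})_* − (ι_1)_*`
vanishes after localisation at `𝔫`. VERBATIM HOME/typer/T-es-12-EsG9-RelativeIharaHomological.lean ecf6b2f2d5f8d0ff
(`EsG9Typed.RelativeIharaCokernelOfCurve`). Classical shape (`t ∤ N`, `n = 1`, any non-Eisenstein `𝔫` of odd residue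
characteristic): Ihara's lemma, Ribet 1984 Thm. 4.1 / tree fact `ribet1984_iharaLemma`; the relative form is NOT in
print (cell memo MEMO-es §21–§23: theorem-candidate; refuter-1 §R42: SURVIVES, CLEAN; placement pending).
[cite: Ribet1984ICM, Thm. 4.1 (shape only: the classical `t ∤ N`, `n = 1` Ihara lemma for `Γ₀`; the relative `t^n ∣ L` curve-localised form is NOT in print — cell memo MEMO-es §22)] -/
@[conjecture]
def RelativeIharaCokernelOfCurve (p t n : ℕ) : Prop :=
  ∀ (W₀ : WeierstrassCurve ℚ) [W₀.IsElliptic] [W₀.IsGloballyMinimal], W₀.HasIrreducibleModPGaloisRep p →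
    ∀ (N d L : ℕ) [NeZero N] [NeZero d] [NeZero L], p.Prime → t.Prime → 1 ≤ n → d = t ^ n → L = d * N →
      ∀ 𝔫 : Ideal (HeckeRing0.primeTo N 2 (t * N)), 𝔫.IsMaximal →
        (p : HeckeRing0.primeTo N 2 (t * N)) ∈ 𝔫 →
        (∀ (r : ℕ) (hr : r.Prime) (hrS : ¬ r ∣ t * N), ¬ r ∣ W₀.conductorNorm ℤ * p →
          HeckeRing0.primeTo.T N 2 (t * N) hr hrS -
            (W₀.frobeniusTrace r : HeckeRing0.primeTo N 2 (t * N)) ∈ 𝔫) →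
        ∃ s : HeckeRing0.primeTo N 2 (t * N), s ∉ 𝔫 ∧
          ∀ x ∈ periodHomology N, ∃ z ∈ periodHomology L,
            (degeneracyMap0 N L d 2).dualMap z - (degeneracyMap0 N L 1 2).dualMap z =
              (s : HeckeRing0 N 2) • x

end Summit.BirchSwinnertonDyer.Rank1Residual.ManinAdditive

end
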